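import Summits.BirchSwinnertonDyer.BirchSwinnertonDyer.Theorems.ManinLocalTwoThreeLineIndexFinite
import Summits.BirchSwinnertonDyer.Rank1Residual.ManinAdditive.ALSignCongruence
import HarnessLib

/-!
# E-desc-26′ divisibility half («index monotonicity is left to the typer»): `r_{AL}(f) ∣ r_{Q_p}(f) ∣ r_f` for `f ∈ S^{AL}`

Summit `BirchSwinnertonDyer`, sub-problem `BirchSwinnertonDyer`, route `ManinLocalTwoThree`; width seat `bsd-line-manin23-p2`
(gen 9), `--supports` the crux C3 `ManinPrimeToThreeAtNine` (stmt-BirchSwinnertonDyer-22968).  Cell `bsd-f2-manin`, desc g11 leaf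
`…ManinAdditive.ALSignCongruence` (`ALCutIndexBetween`, statement only: «since `S^{AL} ⊆ L_{Q_p} ⊆ S` … the cut index lies between
(index monotonicity is left to the typer)»).  The seat's `lineIndex_dvd_of_le` (p653156) is exactly that monotonicity — for `f` IN the
smaller lattice; the leaf's `ALCutIndexBetween` quantifies over ALL `f : CuspForm`, where the first divisibility can fail for junk `f`
(e.g. `f ∉ S^{AL}`, `2f ∈ S^{AL}`, equal Petersson images), so it is NOT closed by name; proved here for `f ∈ S^{AL}` (every newform of a
modular parametrisation datum, `f_mem_alStableLattice`) together with finiteness of all three indices for data.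

PROVED here (no `sorry`): **`alCutIndexBetween_of_mem`**, `alCutIndexBetween_datum`, `lineIndex_alCut_ne_zero`.
BSD is not proved by this; Manin's conjecture is not proved by this.
-/

set_option autoImplicit false
set_option linter.dupNamespace false

noncomputable section

open scoped MatrixGroups ModularForm
open CongruenceSubgroup WeierstrassCurve
open Literature.NumberTheory.EllipticCurves Literature.NumberTheory.EllipticCurves.ModularForms
open Summit.BirchSwinnertonDyer.Rank1Residual.ManinAdditive
open Summit.BirchSwinnertonDyer.Rank1Residual.ManinAdditive.ALSignCongruence

namespace Summit.BirchSwinnertonDyer.BirchSwinnertonDyer.Theorems.ManinLocalTwoThree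

variable {N : ℕ} [NeZero N]

/-- **`r_{AL}(f) ∣ r_{Q_p}(f) ∣ r_f` for `f ∈ S^{AL}`** (`p ∣ N` prime): index monotonicity along `S^{AL} ⊆ L_{Q_p} ⊆ S`. -/
theorem alCutIndexBetween_of_mem {f : CuspForm (Gamma0 N) 2} (hf : f ∈ alStableLattice N) {p : ℕ} (hp : p.Prime)
    (hpN : p ∣ N) :
    lineIndex (alStableLattice N) f ∣ lineIndex (alCutLattice N p) f ∧
      lineIndex (alCutLattice N p) f ∣ lineIndex (integralCuspForms0 N 2) f :=
  ⟨lineIndex_dvd_of_le (alStableLattice_le_alCutLattice hp hpN) hf,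
    lineIndex_dvd_of_le (alCutLattice_le p) (alStableLattice_le_alCutLattice hp hpN hf)⟩

/-- The same for the newform of a modular parametrisation datum (`D.f ∈ S^{AL}`). -/
theorem alCutIndexBetween_datum {W : WeierstrassCurve ℚ} [W.IsElliptic] (D : ModularParametrizationData W N) {p : ℕ}
    (hp : p.Prime) (hpN : p ∣ N) :
    lineIndex (alStableLattice N) D.f ∣ lineIndex (alCutLattice N p) D.f ∧
      lineIndex (alCutLattice N p) D.f ∣ congruenceNumber D.f := by
  rw [← lineIndex_integralCuspForms0]
  exact alCutIndexBetween_of_mem (f_mem_alStableLattice D IsNewform0.exists_atkinLehnerInvolutionAt_eq_smul_holds) hp hpN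

/-- **The AL-cut index `r_{Q_p}(D.f)` is finite** (nonzero), since `r_f ≠ 0` (`congruenceNumber_ne_zero_of_datum`). -/
theorem lineIndex_alCut_ne_zero {W : WeierstrassCurve ℚ} [W.IsElliptic] (D : ModularParametrizationData W N) {p : ℕ}
    (hp : p.Prime) (hpN : p ∣ N) : lineIndex (alCutLattice N p) D.f ≠ 0 :=
  lineIndex_ne_zero_of_mem D (alCutLattice_le p)
    (alStableLattice_le_alCutLattice hp hpN (f_mem_alStableLattice D IsNewform0.exists_atkinLehnerInvolutionAt_eq_smul_holds))

end Summit.BirchSwinnertonDyer.BirchSwinnertonDyer.Theorems.ManinLocalTwoThree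

end
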